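import Mathlib
import HarnessLib
import Summits.HubbardSuperconductivity.HubbardSuperconductivity.Theorems.KLProgrammeKLRegimeTwoVolumeTowerBaseDefs
import Summits.HubbardSuperconductivity.HubbardSuperconductivity.Theorems.KLProgrammeKLRegimeEngineScaleZeroE4GridVertex
import Summits.HubbardSuperconductivity.HubbardSuperconductivity.Theorems.KLProgrammeKLRegimeEngineScaleZeroE4Geometry
import Summits.HubbardSuperconductivity.HubbardSuperconductivity.Theorems.KLProgrammeKLRegimeTwoVolumeTowerSpineKit

/-!
# Route `KLProgramme` — crux K3, VL child `KLRegimeVolumeLimitV17F2` (stmt-HubbardSuperconductivity-20440), blueprint v5 M5 / W4 (base, input side): THE INPUT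
# PROFILE FIELDS OF THE GRID DATA PACKAGE FROM THE EXPLICIT GRID VERTEX (seat hubbard-kl-k3c4-p1 g13; `--supports` 20440)

Three fields of `…TowerBaseGridDataDDefs.TowerGridDataD` concern the INPUT `V_N + 𝒩_K` of the scale-0 step and are data-free: with the canonical budget profile
`NB m′ := [m′=1]·(|β|/N)·Σ_z ‖framePosKernel V K z‖(1 + dist z 0) + [m′=2]·|U||β|/N` (the shape of the fields `hNV`, and of M4a),
* the even pinned profile of `V_N + 𝒩_K` is `≤ NB m′` (field `hNW` with `NW := NB`; `EngineV8.sum_norm_kernel_gridVertex_mul_wt_le` with the weight dropped),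
* `NB ≥ 0`, and the field `hNV` holds with `NV := NB` by reflexivity,
* `normV Γ κ ρ NB ≤ ε_M · ((e²(κ+ρ))²·F + (e²(κ+ρ))⁴·|U|)/2` whenever `Σ_z ‖framePosKernel V K z‖(1 + dist z 0) ≤ F` (field `hνW`; `|β|/N = ε_M/2` for `N = klGridN M = 4M`).

* `towerGrid_inputBudget_nonneg`, `towerGrid_inputProfile_le`, **`towerGrid_normV_inputBudget_le`**.

Proofs only; no definition.
-/

noncomputable section

namespace Summit.HubbardSuperconductivity.HubbardSuperconductivity.Theorems.TwoVolumeSource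

set_option linter.dupNamespace false -- summit = problem name (single-conjunct summit), D-0017

open Finset Filter Topology Literature.MathematicalPhysics.QuantumLattice GrassmannAlgebra Literature.Probability.LatticeModels
open Literature.MathematicalPhysics.QuantumLattice.FermiRG
open Summit.HubbardSuperconductivity.HubbardSuperconductivity.Theorems.KLProgrammeLegKernels
open Summit.HubbardSuperconductivity.HubbardSuperconductivity.Theorems.KLRegimeSplit
open Summit.HubbardSuperconductivity.HubbardSuperconductivity.Theorems.EngineV8
open Summit.HubbardSuperconductivity.HubbardSuperconductivity.Theorems.TwoVolumeDefect

/-- **The canonical input budget is nonnegative.** [folklore] -/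
theorem towerGrid_inputBudget_nonneg {V M : ℕ} [NeZero V] (β U : ℝ) (K : TrigPolyC4v) (m' : ℕ) :
    0 ≤ (if m' = 1 then |β| / (klGridN M : ℕ) * ∑ z : TorusSite 2 V, ‖framePosKernel V K z‖ * (1 + torusSiteDist z 0)
      else if m' = 2 then |U| * |β| / (klGridN M : ℕ) else 0 : ℝ) := by
  split_ifs
  · exact mul_nonneg (by positivity) (sum_nonneg fun z _ => by
      have : 0 ≤ torusSiteDist z 0 := Nat.cast_nonneg _; positivity)
  · positivity
  · exact le_rfl

/-- **The even pinned profile of the grid input `V_N + 𝒩_K` is within the canonical budget** (field `hNW` of `TowerGridDataD` with `NW :=` the budget).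
[folklore: `EngineV8.sum_norm_kernel_gridVertex_mul_wt_le` with the weight `gridLabelWt ≥ 1` dropped] -/
theorem towerGrid_inputProfile_le {V M : ℕ} [NeZero V] [NeZero M] (β U : ℝ) (K : TrigPolyC4v) (m' : ℕ) (j : Fin (2 * m'))
    (x : GridLeg (GridPoint V (klGridN M))) :
    ∑ Y ∈ univ.filter (fun Y : Fin (2 * m') → GridLeg (GridPoint V (klGridN M)) => Y j = x),
        ‖kernel ℂ (hubbardGridInteraction V (klGridN M) β U + hubbardGridCounterQuadratic V (klGridN M) β K) (2 * m') Y‖ ≤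
      (if m' = 1 then |β| / (klGridN M : ℕ) * ∑ z : TorusSite 2 V, ‖framePosKernel V K z‖ * (1 + torusSiteDist z 0)
        else if m' = 2 then |U| * |β| / (klGridN M : ℕ) else 0 : ℝ) := by
  haveI : NeZero (klGridN M) := ⟨mul_ne_zero two_ne_zero (mul_ne_zero two_ne_zero (NeZero.ne M))⟩
  refine le_trans (sum_le_sum fun Y _ => ?_) (sum_norm_kernel_gridVertex_mul_wt_le (L := V) (Ng := klGridN M) β U le_rfl K m' j x)
  exact le_mul_of_one_le_right (norm_nonneg _) (one_le_gridLabelWt _ _ _ _)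

/-- **Field-weighted norm of the canonical input budget**: `normV Γ κ ρ NB ≤ ε_M · ((e²(κ+ρ))²·F + (e²(κ+ρ))⁴·|U|)/2` when the frame kernel's first moment is
`≤ F` (`0 < β`; `|β|/N = ε_M/2` for `N = 4M`). [folklore] -/
theorem towerGrid_normV_inputBudget_le {V M : ℕ} [NeZero V] [NeZero M] (Γ : Type) [Fintype Γ] {β : ℝ} (hβ : 0 < β) (U : ℝ) (K : TrigPolyC4v)
    {κ ρ F : ℝ} (hκ : 0 ≤ κ) (hρ : 0 ≤ ρ) (hF : ∑ z : TorusSite 2 V, ‖framePosKernel V K z‖ * (1 + torusSiteDist z 0) ≤ F) :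
    normV Γ κ ρ (fun m' => if m' = 1 then |β| / (klGridN M : ℕ) * ∑ z : TorusSite 2 V, ‖framePosKernel V K z‖ * (1 + torusSiteDist z 0)
        else if m' = 2 then |U| * |β| / (klGridN M : ℕ) else 0) ≤
      imagTimeWeight β M * (((Real.exp 2 * (κ + ρ)) ^ 2 * F + (Real.exp 2 * (κ + ρ)) ^ 4 * |U|) / 2) := by
  set w : ℝ := Real.exp 2 * (κ + ρ) with hw
  set S : ℝ := ∑ z : TorusSite 2 V, ‖framePosKernel V K z‖ * (1 + torusSiteDist z 0) with hS
  have hS0 : 0 ≤ S := sum_nonneg fun z _ => by have : 0 ≤ torusSiteDist z 0 := Nat.cast_nonneg _; positivity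
  have hN : ((klGridN M : ℕ) : ℝ) = 4 * M := by simp only [klGridN]; push_cast; ring
  have hM : (0 : ℝ) < M := Nat.cast_pos.2 (Nat.pos_of_ne_zero (NeZero.ne M))
  have hbN : |β| / (klGridN M : ℕ) = imagTimeWeight β M / 2 := by
    rw [hN, abs_of_pos hβ, imagTimeWeight]; field_simp; ring
  -- rewrite the budget through `ε_M / 2`
  have hprof : (fun m' : ℕ => if m' = 1 then |β| / (klGridN M : ℕ) * S else if m' = 2 then |U| * |β| / (klGridN M : ℕ) else 0) =
      fun m' => if m' = 1 then imagTimeWeight β M / 2 * S else if m' = 2 then |U| * (imagTimeWeight β M / 2) else 0 := by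
    funext m'; rw [mul_div_assoc |U|, hbN]
  rw [hprof]
  -- the series `Σ w^{2m} NB m` is a finite sum over `{1, 2}`
  set f : ℕ → ℝ := fun m' => w ^ (2 * m') * (if m' = 1 then imagTimeWeight β M / 2 * S else if m' = 2 then |U| * (imagTimeWeight β M / 2) else 0) with hf
  have hsupp : ∀ m' ∉ ({1, 2} : Finset ℕ), f m' = 0 := by
    intro m' hm'
    simp only [mem_insert, mem_singleton, not_or] at hm'
    simp only [hf, if_neg hm'.1, if_neg hm'.2, mul_zero]
  have hsum : HasSum f (∑ m' ∈ ({1, 2} : Finset ℕ), f m') := hasSum_sum_of_ne_finset_zero hsupp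
  have hε0 : 0 ≤ imagTimeWeight β M := by unfold imagTimeWeight; positivity
  have hnn : ∀ m' : ℕ, 0 ≤ (if m' = 1 then imagTimeWeight β M / 2 * S else if m' = 2 then |U| * (imagTimeWeight β M / 2) else 0 : ℝ) := by
    intro m'; split_ifs <;> positivity
  have hle := normV_le_of_hasSum (Γ := Γ) hκ hρ hnn hsum
  refine hle.trans ?_
  rw [sum_pair (by norm_num : (1 : ℕ) ≠ 2)]
  have e1 : f 1 = w ^ 2 * (imagTimeWeight β M / 2 * S) := by simp only [hf]; norm_num
  have e2 : f 2 = w ^ 4 * (|U| * (imagTimeWeight β M / 2)) := by simp only [hf]; norm_num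
  rw [e1, e2]
  have h1 : w ^ 2 * (imagTimeWeight β M / 2 * S) ≤ w ^ 2 * (imagTimeWeight β M / 2 * F) :=
    mul_le_mul_of_nonneg_left (mul_le_mul_of_nonneg_left hF (by positivity)) (by positivity)
  calc w ^ 2 * (imagTimeWeight β M / 2 * S) + w ^ 4 * (|U| * (imagTimeWeight β M / 2))
      ≤ w ^ 2 * (imagTimeWeight β M / 2 * F) + w ^ 4 * (|U| * (imagTimeWeight β M / 2)) := add_le_add h1 le_rfl
    _ = imagTimeWeight β M * (((Real.exp 2 * (κ + ρ)) ^ 2 * F + (Real.exp 2 * (κ + ρ)) ^ 4 * |U|) / 2) := by rw [hw]; ring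

end Summit.HubbardSuperconductivity.HubbardSuperconductivity.Theorems.TwoVolumeSource

end
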